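import Summits.QuantumFields.BalabanUV.T4Continuum.Support.GradedWellTwoLevel
import Summits.QuantumFields.BalabanUV.T4Continuum.Support.GradedWellGram

/-!
# T⁴ programme, spine node NE2 (U1a), sub-row Δ1 — THE GRADED WELL, crew socket (GW-K) part 2a:
# THE GRADED SCALAR MEANS PAIR EXACTLY WITH KING's PLANTING, AND `Δ′_GW = Δ′ + V` WITH `V_{k+1}J₀ = J₀V_k`

NE2 formalisation swarm, leaf-05 (gen 10), socket **(GW-K)** of RULINGS R48/R49 (journal 2026-08-21), on O16-d `GradedWellTwoLevel`
(`rowSLift`: the scalar rows of consecutive levels are the same set) and part 1 `GradedWellGram`.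
 * §1 THE EXACT PAIRING with `J₀ = J0pcT L M k` (King's isometric piecewise-constant planting): `sum_mul_J0`, `J0_mul_apply`,
   **`inSub_cpt_iff`** (a level-`k+1` site lies in the scale-`L·s_i` sub-block of `cpt z` iff its parent lies in the scale-`s_i`
   sub-block of `z`), `sum_meanS_cpt_mul_J0`, **`QsGWn_lift_mul_J0 : (Q′ₙ(k+1)∘rowSLift)·J₀ = Q′ₙ(k)`**, `QsGWw_eq_diag_mul`,
   **`QsGWw_lift_mul_J0`**, `QsGWw_succ_mul_J0`, and the dual **`J0_mul_QsGWw_conjTranspose : J₀·Q′_w(k)ᴴ = (Q′_w(k+1)∘rowSLift)ᴴ`**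
   (the planted weighted indicator IS the lifted one: `w′·(L s)^{−d}·√(L^d)·L^{−d}... = w·s^{−d}·L^{−d/2}`);
 * §2 **`VGW := a′Q′_wᴴQ′_w − a′Π′`**, `DpGW_eq_DeltaPs_add : Δ′_GW = Δ′ + V` (the tier-B4.d torus operator `ScalarAveragedPropagator.DeltaPs`
   plus a bounded perturbation), `QwHQw_succ_mul_J0`, **`VGW_succ_mul_J0 : V_{k+1}·J₀ = J₀·V_k`** (with `PiS_succ_mul_J0pcT`);
 * §3 `nsq_QsGWnH_mulVec`, `nsq_QsGWw_le`, **`opNorm_VGW_le : ‖V‖ ≤ vGW L m a′ = |a′|(L^{2m} + 1)`** — level-free.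
Consumed by `GradedWellGramTwoLevel` (the resolvent transfer of the torus `es`/`ec` numbers and the two-level law of `KGW`).

HONEST FRAMING (T4-DAG p. 1).  [folklore] finite lattice bookkeeping at model level (`U = 1`, one layer map, `m ≤ k` fixed, finite torus);
no estimate of print; NE2 (U1a) NOT proved; spine PROVED 0/9 unchanged; NOT [B9] (3.16)/(3.23)–(3.27)/(3.42) as printed; NOT infinite
volume / mass gap / Clay.  HONEST DEPENDENCY: continuum YM on T⁴ ⇐ BetaPertH ∧ nine spine estimates (0/9 proved); BetaPertH ⇐ (D1) ∧
(D4) ∧ CAP+tail; G-an2-4 gates asym, D1 and NE2/3/4.  No `sorry`.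
-/

noncomputable section

open scoped BigOperators ComplexConjugate Matrix Matrix.Norms.L2Operator
open Finset

namespace Summit.QuantumFields.BalabanUV.T4Continuum.GradedWellGramPairing

open Literature.MathematicalPhysics.QuantumFieldTheory.Balaban1983to89.B5Prop11Plancherel (Tor fine opNorm_le_of_sq_le)
open Literature.MathematicalPhysics.QuantumFieldTheory.Balaban1983to89.B5Prop11Lower (nsq nsq_nonneg star_dotProduct_self nsq_mulVec_le)
open Literature.MathematicalPhysics.QuantumFieldTheory.Balaban1983to89.B5Blocks16 (blockOf)
open Literature.MathematicalPhysics.QuantumFieldTheory.Balaban1983to89.B5G183RateTorus (cpt)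
open Literature.MathematicalPhysics.QuantumFieldTheory.Balaban1983to89.B5G183RateUnitTower (lev lev_neZero)
open Summit.QuantumFields.BalabanUV.T4Continuum
open Summit.QuantumFields.BalabanUV.T4Continuum.ScalarBlockPoincare (PiS nsq_PiS_mulVec_le nsq_smul)
open Summit.QuantumFields.BalabanUV.T4Continuum.ScalarAveragedPropagator (DeltaPs gammaPs)
open Summit.QuantumFields.BalabanUV.T4Continuum.ScalarBlockPlanting (JK0 Qavg0 star_Qavg0_apply Qavg0_mul_apply
  Qavg0_conjTranspose_mul_apply)
open Summit.QuantumFields.BalabanUV.T4Continuum.ScalarPlantingDefect (J0pcT PiS_succ_mul_J0pcT opNorm_J0pcT_le)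
open Literature.MathematicalPhysics.QuantumFieldTheory.Balaban1983to89.B5G183RateTorusW (off)
open Summit.QuantumFields.BalabanUV.T4Continuum.BalabanAveragedTowerModes (par val_par par_cpt_add_off)
open Summit.QuantumFields.BalabanUV.T4Continuum.RegionGaugeProjection (gramK)
open Summit.QuantumFields.BalabanUV.T4Continuum.RegionGaugeSlice (form_gram)
open Summit.QuantumFields.BalabanUV.T4Continuum.GradedSubBlocks (Anchor Anc InSub meanS s_pos)
open Summit.QuantumFields.BalabanUV.T4Continuum.GradedWellData
open Summit.QuantumFields.BalabanUV.T4Continuum.GradedWellSlice (QsGWn QsGWn_mul_conjTranspose)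
open Summit.QuantumFields.BalabanUV.T4Continuum.GradedWellTwoLevel (val_cpt' sGW_succ anchor_lift rowSLift KGW KGWL)
open Summit.QuantumFields.BalabanUV.T4Continuum.GradedWellGram (sigGW sigGW_pos isUnit_det_gramK_GW opNorm_inv_gramK_GW_le
  nsq_mulVec_le_of_mul_conjTranspose_eq_one)

variable {d : ℕ} (L : ℕ) [NeZero L] (M : Fin d → ℕ) [hM : ∀ μ, NeZero (M μ)] (k m : ℕ) (layer : Tor M → ℕ) (a' : ℝ)

/-! ## §1 The exact pairing of the graded means with King's planting -/

/-- `0 < √(L^d)`. [folklore] -/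
theorem sqrtL_pos : 0 < Real.sqrt ((L : ℝ) ^ d) :=
  Real.sqrt_pos.mpr (pow_pos (by exact_mod_cast Nat.pos_of_ne_zero (NeZero.ne L)) d)

/-- column sums against `J₀`: `Σ_{x′} F(x′)·J₀(x′, y) = √(L^d)·L^{−d}·Σ_j F(L·y + j)`. [folklore] -/
theorem sum_mul_J0 (F : TorK L M (k + 1) → ℂ) (y : TorK L M k) :
    ∑ x', F x' * J0pcT L M k x' y = ((Real.sqrt ((L : ℝ) ^ d) : ℝ) : ℂ) *
      ((((L : ℂ) ^ d)⁻¹) * ∑ j : Fin d → Fin L, F (cpt (lev L k) L M y + off (lev L k) L M j)) := by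
  have h := Qavg0_mul_apply (lev L k) L M (Matrix.of fun x' (_ : Unit) => F x') y ()
  simp only [Matrix.mul_apply, Matrix.of_apply] at h
  rw [← h, Finset.mul_sum]
  refine Finset.sum_congr rfl fun x' _ => ?_
  rw [show J0pcT L M k x' y = JK0 (lev L k) L M x' y from rfl, JK0, Matrix.smul_apply, Matrix.conjTranspose_apply,
    star_Qavg0_apply, smul_eq_mul]
  ring

/-- row action of `J₀`: `(J₀·Y)(x′, b) = √(L^d)·L^{−d}·Y(par x′, b)`. [folklore] -/
theorem J0_mul_apply {β : Type*} (Y : Matrix (TorK L M k) β ℂ) (x' : TorK L M (k + 1)) (b : β) :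
    (J0pcT L M k * Y) x' b = ((Real.sqrt ((L : ℝ) ^ d) : ℝ) : ℂ) * ((((L : ℂ) ^ d)⁻¹) * Y (par (lev L k) L M x') b) := by
  show (JK0 (lev L k) L M * Y) x' b = _
  rw [JK0, Matrix.smul_mul, Matrix.smul_apply, Qavg0_conjTranspose_mul_apply, smul_eq_mul]

/-- **membership lifts**: a level-`k+1` site lies in the scale-`L·s_i` sub-block of `cpt z` iff its parent lies in the scale-`s_i`
sub-block of `z`. [folklore] -/
theorem inSub_cpt_iff {i : ℕ} (hi : i ≤ k) (z : TorK L M k) (x' : TorK L M (k + 1)) :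
    InSub (fine (lev L (k + 1)) M) (sGW L (k + 1) i) (cpt (lev L k) L M z) x' ↔
      InSub (fine (lev L k) M) (sGW L k i) z (par (lev L k) L M x') := by
  have hL : 0 < L := Nat.pos_of_ne_zero (NeZero.ne L)
  unfold InSub
  rw [sGW_succ L k hi]
  refine forall_congr' fun ν => ?_
  show (x' ν).val / (L * sGW L k i) = (cpt (lev L k) L M z ν).val / (L * sGW L k i) ↔
    (par (lev L k) L M x' ν).val / sGW L k i = (z ν).val / sGW L k i
  rw [val_cpt', val_par, Nat.mul_div_mul_left _ _ hL, Nat.div_div_eq_div_mul]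
  exact Iff.rfl

omit [NeZero L] hM in
/-- `√(L^d)·√(L^d) = L^d` in `ℂ`. [folklore] -/
theorem sqrtL_mul_self : ((Real.sqrt ((L : ℝ) ^ d) : ℝ) : ℂ) * ((Real.sqrt ((L : ℝ) ^ d) : ℝ) : ℂ) = (L : ℂ) ^ d := by
  rw [← Complex.ofReal_mul, Real.mul_self_sqrt (pow_nonneg (Nat.cast_nonneg _) d)]
  push_cast
  rfl

/-- the scalar identity behind the pairings: `√(L^d)·(L^{−d}·(L^d·((L^d·S))⁻¹)) = (√(L^d))⁻¹·S⁻¹`. [folklore] -/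
theorem pair_factor (S : ℂ) (hS : S ≠ 0) :
    ((Real.sqrt ((L : ℝ) ^ d) : ℝ) : ℂ) * ((((L : ℂ) ^ d)⁻¹) * (((L : ℂ) ^ d) * (((L : ℂ) ^ d) * S)⁻¹))
      = (((Real.sqrt ((L : ℝ) ^ d) : ℝ) : ℂ))⁻¹ * S⁻¹ := by
  have hr : ((Real.sqrt ((L : ℝ) ^ d) : ℝ) : ℂ) ≠ 0 := by exact_mod_cast (sqrtL_pos L (d := d)).ne'
  have hA : ((L : ℂ) ^ d) ≠ 0 := pow_ne_zero _ (by exact_mod_cast NeZero.ne L)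
  have hrr := sqrtL_mul_self L (d := d)
  field_simp
  linear_combination hrr

/-- **the lifted sub-block mean pairs exactly**: `Σ_{x′} meanS_{L s}(cpt z)(x′)·J₀(x′, y) = (√(L^d))⁻¹·meanS_s(z)(y)`. [folklore] -/
theorem sum_meanS_cpt_mul_J0 {i : ℕ} (hi : i ≤ k) (z : Anc (fine (lev L k) M) (sGW L k i)) (y : TorK L M k) :
    ∑ x', meanS (fine (lev L (k + 1)) M) (sGW L (k + 1) i) ⟨cpt (lev L k) L M z.1, anchor_lift L M k hi z.2⟩ x' * J0pcT L M k x' y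
      = (((Real.sqrt ((L : ℝ) ^ d))⁻¹ : ℝ) : ℂ) * meanS (fine (lev L k) M) (sGW L k i) z y := by
  rw [sum_mul_J0]
  have e1 : ∀ j : Fin d → Fin L, meanS (fine (lev L (k + 1)) M) (sGW L (k + 1) i) ⟨cpt (lev L k) L M z.1, anchor_lift L M k hi z.2⟩
      (cpt (lev L k) L M y + off (lev L k) L M j)
      = if InSub (fine (lev L k) M) (sGW L k i) z.1 y then ((((sGW L (k + 1) i : ℕ) : ℂ)) ^ d)⁻¹ else 0 := by
    intro j
    simp only [meanS]
    by_cases h : InSub (fine (lev L k) M) (sGW L k i) z.1 y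
    · rw [if_pos h, if_pos ((inSub_cpt_iff L M k hi z.1 _).mpr (by rwa [par_cpt_add_off]))]
    · rw [if_neg h, if_neg fun h' => h (by have h2 := (inSub_cpt_iff L M k hi z.1 _).mp h'; rwa [par_cpt_add_off] at h2)]
  simp_rw [e1]
  rw [Finset.sum_const, Finset.card_univ, Fintype.card_fun, Fintype.card_fin, Fintype.card_fin, nsmul_eq_mul, sGW_succ L k hi]
  simp only [meanS]
  have hS : (((sGW L k i : ℕ) : ℂ)) ^ d ≠ 0 := pow_ne_zero _ (by exact_mod_cast NeZero.ne (sGW L k i))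
  split_ifs with h
  · push_cast
    rw [mul_pow]
    exact pair_factor L _ hS
  · simp

/-- **THE NORMALISED ROWS PAIR EXACTLY**: `(Q′ₙ(k+1) ∘ rowSLift)·J₀ = Q′ₙ(k)` (`√((Ls)^d)·(√(L^d))⁻¹ = √(s^d)`). [folklore] -/
theorem QsGWn_lift_mul_J0 (hk : m ≤ k) :
    (QsGWn L M (k + 1) m layer).submatrix (rowSLift L M k m layer hk) id * J0pcT L M k = QsGWn L M k m layer := by
  ext p y
  have hi : (p.1.1 : ℕ) ≤ k := le_trans (Nat.le_of_lt_succ p.1.1.isLt) hk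
  rw [Matrix.mul_apply]
  have e1 : ∀ x', (QsGWn L M (k + 1) m layer).submatrix (rowSLift L M k m layer hk) id p x' * J0pcT L M k x' y
      = ((Real.sqrt ((((sGW L (k + 1) p.1.1 : ℕ) : ℝ)) ^ d) : ℝ) : ℂ) *
        (meanS (fine (lev L (k + 1)) M) (sGW L (k + 1) p.1.1) ⟨cpt (lev L k) L M p.1.2.1, anchor_lift L M k hi p.1.2.2⟩ x' *
          J0pcT L M k x' y) := fun x' => by rw [← mul_assoc]; rfl
  simp_rw [e1]
  rw [← Finset.mul_sum, sum_meanS_cpt_mul_J0 L M k hi, ← mul_assoc]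
  show _ = ((Real.sqrt ((((sGW L k p.1.1 : ℕ) : ℝ)) ^ d) : ℝ) : ℂ) * meanS (fine (lev L k) M) (sGW L k p.1.1) p.1.2 y
  congr 1
  rw [← Complex.ofReal_mul]
  congr 1
  rw [sGW_succ L k hi, Nat.cast_mul, mul_pow, Real.sqrt_mul' _ (pow_nonneg (Nat.cast_nonneg _) d), mul_right_comm,
    mul_inv_cancel₀ (sqrtL_pos L (d := d)).ne', one_mul]

/-- `Q′_w = diag(L^{i_p})·Q′ₙ` (`w_p = L^{i_p}√(s_p^d)`). [folklore] -/
theorem QsGWw_eq_diag_mul : QsGWw L M k m layer =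
    Matrix.diagonal (fun p : RowS L M k m layer => ((L : ℂ)) ^ (p.1.1 : ℕ)) * QsGWn L M k m layer := by
  ext p y
  rw [Matrix.diagonal_mul]
  simp only [QsGWw, QsGWn, wGW]
  push_cast
  ring

/-- **the weighted rows pair exactly**: `(Q′_w(k+1) ∘ rowSLift)·J₀ = Q′_w(k)`. [folklore] -/
theorem QsGWw_lift_mul_J0 (hk : m ≤ k) :
    (QsGWw L M (k + 1) m layer).submatrix (rowSLift L M k m layer hk) id * J0pcT L M k = QsGWw L M k m layer := by
  rw [QsGWw_eq_diag_mul L M (k + 1), QsGWw_eq_diag_mul L M k, ← QsGWn_lift_mul_J0 L M k m layer hk, ← Matrix.mul_assoc,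
    ← Matrix.submatrix_mul_equiv _ _ _ (rowSLift L M k m layer hk) _, Matrix.submatrix_diagonal_equiv]
  rfl

/-- the unreindexed form: `Q′_w(k+1)·J₀ = Q′_w(k) ∘ rowSLift⁻¹`. [folklore] -/
theorem QsGWw_succ_mul_J0 (hk : m ≤ k) :
    QsGWw L M (k + 1) m layer * J0pcT L M k = (QsGWw L M k m layer).submatrix (rowSLift L M k m layer hk).symm id := by
  rw [← QsGWw_lift_mul_J0 L M k m layer hk]
  ext q y
  simp only [Matrix.mul_apply, Matrix.submatrix_apply, id, Equiv.apply_symm_apply]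

/-- **the dual pairing**: `J₀·Q′_w(k)ᴴ = (Q′_w(k+1) ∘ rowSLift)ᴴ` (the lifted weighted indicator IS the planted one). [folklore] -/
theorem J0_mul_QsGWw_conjTranspose (hk : m ≤ k) :
    J0pcT L M k * (QsGWw L M k m layer)ᴴ = ((QsGWw L M (k + 1) m layer).submatrix (rowSLift L M k m layer hk) id)ᴴ := by
  ext x' p
  have hi : (p.1.1 : ℕ) ≤ k := le_trans (Nat.le_of_lt_succ p.1.1.isLt) hk
  rw [J0_mul_apply, Matrix.conjTranspose_apply, Matrix.conjTranspose_apply, Matrix.submatrix_apply]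
  show _ = star (((wGW L (k + 1) d p.1.1 : ℝ) : ℂ) *
    meanS (fine (lev L (k + 1)) M) (sGW L (k + 1) p.1.1) ⟨cpt (lev L k) L M p.1.2.1, anchor_lift L M k hi p.1.2.2⟩ x')
  simp only [QsGWw, QsGW, meanS, wGW]
  by_cases h : InSub (fine (lev L k) M) (sGW L k p.1.1) p.1.2.1 (par (lev L k) L M x')
  · rw [if_pos h, if_pos ((inSub_cpt_iff L M k hi p.1.2.1 x').mpr h), sGW_succ L k hi]
    simp only [star_mul', Complex.star_def, Complex.conj_ofReal, map_inv₀, map_pow, Complex.conj_natCast]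
    push_cast
    rw [mul_pow, Real.sqrt_mul' _ (pow_nonneg (Nat.cast_nonneg _) d)]
    push_cast
    rw [mul_pow, mul_inv]
    ring
  · rw [if_neg h, if_neg fun h' => h ((inSub_cpt_iff L M k hi p.1.2.1 x').mp h')]
    simp

/-! ## §2 The graded-mass perturbation `V` and its exact intertwining -/

/-- **THE GRADED-MASS PERTURBATION** `V := a′·Q′_wᴴQ′_w − a′·Π′` of the tier-B4.d torus operator `Δ′ = −Δ + a′Π′`:
`Δ′_GW = Δ′ + V`. [folklore] -/
def VGW : Matrix (TorK L M k) (TorK L M k) ℂ :=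
  (a' : ℂ) • ((QsGWw L M k m layer)ᴴ * QsGWw L M k m layer) - (a' : ℂ) • PiS (lev L k) M

/-- `Δ′_GW = Δ′ + V`. [folklore] -/
theorem DpGW_eq_DeltaPs_add : DpGW L M k m layer a' = DeltaPs (lev L k) M a' + VGW L M k m layer a' := by
  unfold DpGW DeltaPs VGW
  abel

/-- `Q′_w(k+1)ᴴQ′_w(k+1)·J₀ = J₀·Q′_w(k)ᴴQ′_w(k)` — the graded mass intertwines EXACTLY with the planting. [folklore] -/
theorem QwHQw_succ_mul_J0 (hk : m ≤ k) :
    (QsGWw L M (k + 1) m layer)ᴴ * QsGWw L M (k + 1) m layer * J0pcT L M k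
      = J0pcT L M k * ((QsGWw L M k m layer)ᴴ * QsGWw L M k m layer) := by
  have h1 : (QsGWw L M (k + 1) m layer)ᴴ * QsGWw L M (k + 1) m layer
      = ((QsGWw L M (k + 1) m layer).submatrix (rowSLift L M k m layer hk) id)ᴴ *
          (QsGWw L M (k + 1) m layer).submatrix (rowSLift L M k m layer hk) id := by
    rw [Matrix.conjTranspose_submatrix, Matrix.submatrix_mul_equiv, Matrix.submatrix_id_id]
  rw [h1, Matrix.mul_assoc, QsGWw_lift_mul_J0 L M k m layer hk, ← J0_mul_QsGWw_conjTranspose L M k m layer hk,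
    Matrix.mul_assoc]

/-- **`V_{k+1}·J₀ = J₀·V_k`**. [folklore] -/
theorem VGW_succ_mul_J0 (hk : m ≤ k) :
    VGW L M (k + 1) m layer a' * J0pcT L M k = J0pcT L M k * VGW L M k m layer a' := by
  unfold VGW
  rw [Matrix.sub_mul, Matrix.mul_sub, Matrix.smul_mul, Matrix.smul_mul, Matrix.mul_smul, Matrix.mul_smul,
    QwHQw_succ_mul_J0 L M k m layer hk]
  show _ - (a' : ℂ) • (PiS (lev L (k + 1)) M * J0pcT L M k) = _
  rw [PiS_succ_mul_J0pcT]

/-! ## §3 Norm of `V` -/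

/-- `nsq (Q′ₙᴴ u) = nsq u` (orthonormal rows). [folklore] -/
theorem nsq_QsGWnH_mulVec (u : RowS L M k m layer → ℂ) : nsq ((QsGWn L M k m layer)ᴴ *ᵥ u) = nsq u := by
  have h := form_gram ((QsGWn L M k m layer)ᴴ) u
  rw [Matrix.conjTranspose_conjTranspose, QsGWn_mul_conjTranspose, Matrix.one_mulVec, star_dotProduct_self] at h
  exact_mod_cast h.symm

/-- `nsq (Q′_w f) ≤ L^{2m}·nsq f` and `nsq (Q′_wᴴ u) ≤ L^{2m}·nsq u` (`Q′_w = diag(L^{i_p})Q′ₙ`, `i_p ≤ m`). [folklore] -/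
theorem nsq_QsGWw_le (f : TorK L M k → ℂ) (u : RowS L M k m layer → ℂ) :
    nsq (QsGWw L M k m layer *ᵥ f) ≤ ((L : ℝ) ^ m) ^ 2 * nsq f ∧
      nsq ((QsGWw L M k m layer)ᴴ *ᵥ u) ≤ ((L : ℝ) ^ m) ^ 2 * nsq u := by
  have hL : (1 : ℝ) ≤ L := by exact_mod_cast Nat.one_le_iff_ne_zero.mpr (NeZero.ne L)
  have hD : ∀ v : RowS L M k m layer → ℂ,
      nsq (Matrix.diagonal (fun p : RowS L M k m layer => ((L : ℂ)) ^ (p.1.1 : ℕ)) *ᵥ v) ≤ ((L : ℝ) ^ m) ^ 2 * nsq v := by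
    intro v
    unfold nsq
    rw [Finset.mul_sum]
    refine Finset.sum_le_sum fun p _ => ?_
    rw [Matrix.mulVec_diagonal, norm_mul, mul_pow, norm_pow, Complex.norm_natCast]
    exact mul_le_mul_of_nonneg_right (pow_le_pow_left₀ (by positivity)
      (pow_le_pow_right₀ hL (Nat.le_of_lt_succ p.1.1.isLt)) 2) (sq_nonneg _)
  have hDH : (Matrix.diagonal (fun p : RowS L M k m layer => ((L : ℂ)) ^ (p.1.1 : ℕ)))ᴴ
      = Matrix.diagonal (fun p : RowS L M k m layer => ((L : ℂ)) ^ (p.1.1 : ℕ)) := by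
    rw [Matrix.diagonal_conjTranspose]
    congr 1
    funext p
    simp
  constructor
  · rw [QsGWw_eq_diag_mul, ← Matrix.mulVec_mulVec]
    exact (hD _).trans (mul_le_mul_of_nonneg_left
      (nsq_mulVec_le_of_mul_conjTranspose_eq_one _ (QsGWn_mul_conjTranspose L M k m layer) f) (by positivity))
  · rw [QsGWw_eq_diag_mul, Matrix.conjTranspose_mul, hDH, ← Matrix.mulVec_mulVec, nsq_QsGWnH_mulVec]
    exact hD u

/-- the level-free cap `v_GW = |a′|·(L^{2m} + 1) ≥ ‖V‖`. [folklore] -/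
def vGW (L m : ℕ) (a' : ℝ) : ℝ := |a'| * (((L : ℝ) ^ m) ^ 2 + 1)

/-- **`‖V‖ ≤ v_GW`** — level-free. [folklore] -/
theorem opNorm_VGW_le : ‖VGW L M k m layer a'‖ ≤ vGW L m a' := by
  have h1 : ‖(QsGWw L M k m layer)ᴴ * QsGWw L M k m layer‖ ≤ ((L : ℝ) ^ m) ^ 2 := by
    refine opNorm_le_of_sq_le _ (by positivity) fun x => ?_
    show nsq (((QsGWw L M k m layer)ᴴ * QsGWw L M k m layer) *ᵥ x) ≤ _
    rw [← Matrix.mulVec_mulVec]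
    calc nsq ((QsGWw L M k m layer)ᴴ *ᵥ (QsGWw L M k m layer *ᵥ x))
        ≤ ((L : ℝ) ^ m) ^ 2 * nsq (QsGWw L M k m layer *ᵥ x) := (nsq_QsGWw_le L M k m layer x _).2
      _ ≤ ((L : ℝ) ^ m) ^ 2 * (((L : ℝ) ^ m) ^ 2 * nsq x) :=
          mul_le_mul_of_nonneg_left (nsq_QsGWw_le L M k m layer x (0 : RowS L M k m layer → ℂ)).1 (by positivity)
      _ = (((L : ℝ) ^ m) ^ 2) ^ 2 * nsq x := by ring
  have h2 : ‖PiS (lev L k) M‖ ≤ 1 :=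
    opNorm_le_of_sq_le _ zero_le_one fun x => by
      have h := nsq_PiS_mulVec_le (lev L k) M x
      rw [one_pow, one_mul]; exact h
  unfold VGW vGW
  calc ‖(a' : ℂ) • ((QsGWw L M k m layer)ᴴ * QsGWw L M k m layer) - (a' : ℂ) • PiS (lev L k) M‖
      ≤ ‖(a' : ℂ) • ((QsGWw L M k m layer)ᴴ * QsGWw L M k m layer)‖ + ‖(a' : ℂ) • PiS (lev L k) M‖ := norm_sub_le _ _
    _ ≤ |a'| * ((L : ℝ) ^ m) ^ 2 + |a'| * 1 := by
        rw [norm_smul, norm_smul, Complex.norm_real, Real.norm_eq_abs]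
        exact add_le_add (mul_le_mul_of_nonneg_left h1 (abs_nonneg _)) (mul_le_mul_of_nonneg_left h2 (abs_nonneg _))
    _ = |a'| * (((L : ℝ) ^ m) ^ 2 + 1) := by ring

end Summit.QuantumFields.BalabanUV.T4Continuum.GradedWellGramPairing

end
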